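import Literature.Topology.FourManifolds.SurfaceGroupCoveringLifts
import Literature.GroupTheory.CombinatorialGroupTheory.ReidemeisterSchreier
import Literature.GroupTheory.CombinatorialGroupTheory.AbelianizationFinrank
import Mathlib.LinearAlgebra.Dimension.Constructions
import HarnessLib

/-!
# Finite-index subgroups of surface groups, II: the relation module modulo `[E, N]` is spanned by
# the transversal conjugates of the relator; the rank of `H₁(S_h)`

Topic `Literature/Topology/FourManifolds`; theorems only; continuation of `SurfaceGroupCoveringLifts.lean`
(notation `F, R = ker proj_g, K ≤ S_g, E = proj⁻¹ K, π_E, N = ker π_E, C = [E, N]`, transversal `u`).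

* `ker_subgroupComap_eq_normalClosure_range` — Reidemeister–Schreier: `N` is the normal closure IN `E`
  of the conjugates `u_q⁻¹ r_g u_q` (`ReidemeisterSchreier.subgroupOf_normalClosure_eq`);
* `ofMul_mk_mem_span` — modulo `C` these conjugates are central in `E/C`, and every element of `N`
  is, in the `ℤ`-module `Additive (center (E ⧸ C))`, a `ℤ`-combination of their classes (Hopf's
  `N/[E,N]` is generated by the lifted relators — K. S. Brown, *Cohomology of Groups*, II §5 Ex. 5(b));
* `span_image_ker_eq_span_range` — in `H₁(E) = Additive (Abelianization E)` the image of `N` is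
  spanned by the images of the conjugates;
* `nonempty_additive_abelianization_surfaceGroup_linearEquiv` /
  `finrank_additive_abelianization_surfaceGroup` — `H₁(S_h) = ℤ^{2h}` as a `ℤ`-module, through the
  tree's Hurewicz map `SurfaceGroup.abelianize` (`SurfaceGroupHomology.lean`,
  `SurfaceGroupAbelianisationKernels.lean`: onto `surfaceGen h → ℤ`, kernel `[S_h, S_h]`).

No definitions.  The `ℤ`-module structure on `Additive (center _)` is Mathlib's scoped
`IsMulCommutative` instance.  (Note for files in namespace
`Literature.GroupTheory.CombinatorialGroupTheory` importing `HopfLiftLemmas`: there `open Subgroup` must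
be spelled `open _root_.Subgroup`, since that file declares `…CombinatorialGroupTheory.Subgroup.*`.)
-/

noncomputable section

open scoped IsMulCommutative

namespace Literature.Topology.FourManifolds

namespace SurfaceGroup

open Literature.GroupTheory.CombinatorialGroupTheory Subgroup
open scoped commutatorElement

variable {g h : ℕ}

/-! ### `N` is the normal closure in `E` of the transversal conjugates of the relator -/

/-- For a transversal `u` of `F/E` (`u_q ∈ q`): every `f ∈ F` is `k · u_q⁻¹` with `k ∈ E`
(`q` = the coset of `f⁻¹`). [cite: LyndonSchupp2001, Ch. II Prop. 4.1] -/
theorem exists_mem_comap_mul_inv_transversal (K : Subgroup (SurfaceGroup g))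
    (u : FreeGroup (surfaceGen g) ⧸ K.comap (proj g) → FreeGroup (surfaceGen g))
    (hu : ∀ q, (u q : FreeGroup (surfaceGen g) ⧸ K.comap (proj g)) = q) (f : FreeGroup (surfaceGen g)) :
    ∃ k ∈ K.comap (proj g), ∃ t ∈ Set.range (fun q => (u q)⁻¹), f = k * t := by
  refine ⟨f * u (f⁻¹ : FreeGroup (surfaceGen g)), ?_, (u (f⁻¹ : FreeGroup (surfaceGen g)))⁻¹,
    ⟨_, rfl⟩, by group⟩
  have h1 := hu (f⁻¹ : FreeGroup (surfaceGen g))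
  rw [QuotientGroup.eq] at h1
  have h2 := (K.comap (proj g)).inv_mem h1
  simpa only [mul_inv_rev, inv_inv] using h2

/-- **Reidemeister–Schreier for the relation subgroup**: `N = ker π_E` is the normal closure in `E`
of the conjugates `u_q⁻¹ r_g u_q`, `q ∈ F/E`. [cite: LyndonSchupp2001, Ch. II Prop. 4.1] -/
theorem ker_subgroupComap_eq_normalClosure_range (K : Subgroup (SurfaceGroup g))
    (u : FreeGroup (surfaceGen g) ⧸ K.comap (proj g) → FreeGroup (surfaceGen g))
    (hu : ∀ q, (u q : FreeGroup (surfaceGen g) ⧸ K.comap (proj g)) = q) :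
    ((proj g).subgroupComap K).ker =
      normalClosure (Set.range fun q => (⟨(u q)⁻¹ * surfaceRelator g * u q,
        conj_relator_mem_comap K (u q)⟩ : K.comap (proj g))) := by
  rw [ker_subgroupComap_eq, ker_proj_eq_normalClosure,
    subgroupOf_normalClosure_eq _ (K.comap (proj g))
      (by rw [← ker_proj_eq_normalClosure]; exact ker_proj_le_comap K) _
      (exists_mem_comap_mul_inv_transversal K u hu)]
  congr 1
  ext y
  simp only [Set.mem_setOf_eq, Set.mem_range, Set.mem_singleton_iff, exists_eq_left,
    exists_exists_eq_and, inv_inv]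
  constructor
  · rintro ⟨q, hq⟩
    exact ⟨q, Subtype.ext hq.symm⟩
  · rintro ⟨q, rfl⟩
    exact ⟨q, rfl⟩

/-- Each conjugate `u_q⁻¹ r_g u_q` lies in `N`. [cite: LyndonSchupp2001, Ch. II Prop. 4.1] -/
theorem conj_relator_mem_ker_subgroupComap (K : Subgroup (SurfaceGroup g)) (v : FreeGroup (surfaceGen g)) :
    (⟨v⁻¹ * surfaceRelator g * v, conj_relator_mem_comap K v⟩ : K.comap (proj g)) ∈
      ((proj g).subgroupComap K).ker := by
  rw [ker_subgroupComap_eq, mem_subgroupOf]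
  exact conj_relator_mem_ker v

/-- A list product of the conjugates lies in `N`. [cite: LyndonSchupp2001, Ch. II Prop. 4.1] -/
theorem prod_conj_relator_mem_ker (K : Subgroup (SurfaceGroup g))
    (u : FreeGroup (surfaceGen g) ⧸ K.comap (proj g) → FreeGroup (surfaceGen g))
    (l : List (FreeGroup (surfaceGen g) ⧸ K.comap (proj g))) :
    (l.map fun q => (⟨(u q)⁻¹ * surfaceRelator g * u q, conj_relator_mem_comap K (u q)⟩ :
        K.comap (proj g))).prod ∈ ((proj g).subgroupComap K).ker := by
  apply Subgroup.list_prod_mem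
  intro x hx
  rw [List.mem_map] at hx
  obtain ⟨q, -, rfl⟩ := hx
  exact conj_relator_mem_ker_subgroupComap K (u q)

/-! ### Modulo `C = [E, N]`: the classes of the conjugates span the image of `N` -/

/-- **Hopf's `N/[E,N]` is generated by the lifted relators.**  In the `ℤ`-module
`Additive (center (E ⧸ [E, N]))` (the image of `N` is central), the class of every `x ∈ N` lies in the
`ℤ`-span of the classes of the conjugates `u_q⁻¹ r_g u_q`.
[cite: Brown1982CohomologyGroups, II §5 Ex 5] -/
theorem ofMul_mk_mem_span (K : Subgroup (SurfaceGroup g))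
    (u : FreeGroup (surfaceGen g) ⧸ K.comap (proj g) → FreeGroup (surfaceGen g))
    (hu : ∀ q, (u q : FreeGroup (surfaceGen g) ⧸ K.comap (proj g)) = q)
    {x : K.comap (proj g)} (hx : x ∈ ((proj g).subgroupComap K).ker)
    (hxc : (QuotientGroup.mk x : K.comap (proj g) ⧸
        ⁅(⊤ : Subgroup (K.comap (proj g))), ((proj g).subgroupComap K).ker⁆) ∈
      Subgroup.center (K.comap (proj g) ⧸ ⁅(⊤ : Subgroup (K.comap (proj g))), ((proj g).subgroupComap K).ker⁆)) :
    Additive.ofMul (⟨_, hxc⟩ : Subgroup.center (K.comap (proj g) ⧸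
        ⁅(⊤ : Subgroup (K.comap (proj g))), ((proj g).subgroupComap K).ker⁆)) ∈
      Submodule.span ℤ (Set.range fun q : FreeGroup (surfaceGen g) ⧸ K.comap (proj g) =>
        Additive.ofMul (⟨QuotientGroup.mk (⟨(u q)⁻¹ * surfaceRelator g * u q,
            conj_relator_mem_comap K (u q)⟩ : K.comap (proj g)),
          QuotientGroup.mk_mem_center_of_mem _ (conj_relator_mem_ker_subgroupComap K (u q))⟩ :
          Subgroup.center (K.comap (proj g) ⧸
            ⁅(⊤ : Subgroup (K.comap (proj g))), ((proj g).subgroupComap K).ker⁆))) := by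
  -- abbreviations
  set N := ((proj g).subgroupComap K).ker with hNdef
  set rE : FreeGroup (surfaceGen g) ⧸ K.comap (proj g) → K.comap (proj g) := fun q =>
    ⟨(u q)⁻¹ * surfaceRelator g * u q, conj_relator_mem_comap K (u q)⟩ with hrE
  have hN : N = normalClosure (Set.range rE) := ker_subgroupComap_eq_normalClosure_range K u hu
  -- induction over the normal closure `closure (conjugatesOfSet (range rE))`
  have key : ∀ y ∈ normalClosure (Set.range rE),
      ∀ hy : (QuotientGroup.mk y : K.comap (proj g) ⧸ ⁅(⊤ : Subgroup (K.comap (proj g))), N⁆) ∈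
        Subgroup.center (K.comap (proj g) ⧸ ⁅(⊤ : Subgroup (K.comap (proj g))), N⁆),
      Additive.ofMul (⟨_, hy⟩ : Subgroup.center (K.comap (proj g) ⧸ ⁅(⊤ : Subgroup (K.comap (proj g))), N⁆)) ∈
        Submodule.span ℤ (Set.range fun q => Additive.ofMul
          (⟨QuotientGroup.mk (rE q), QuotientGroup.mk_mem_center_of_mem _
            (conj_relator_mem_ker_subgroupComap K (u q))⟩ :
            Subgroup.center (K.comap (proj g) ⧸ ⁅(⊤ : Subgroup (K.comap (proj g))), N⁆))) := by
    intro y hy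
    change y ∈ Subgroup.closure (Group.conjugatesOfSet (Set.range rE)) at hy
    induction hy using Subgroup.closure_induction with
    | mem z hz =>
      intro hzc
      obtain ⟨s, ⟨q, rfl⟩, hc⟩ := Group.mem_conjugatesOfSet_iff.mp hz
      obtain ⟨c, rfl⟩ := isConj_iff.mp hc
      have hq : rE q ∈ N := conj_relator_mem_ker_subgroupComap K (u q)
      have hcen := QuotientGroup.mk_mem_center_of_mem N hq
      have heq : (QuotientGroup.mk (c * rE q * c⁻¹) : K.comap (proj g) ⧸ ⁅(⊤ : Subgroup (K.comap (proj g))), N⁆) =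
          QuotientGroup.mk (rE q) := by
        rw [QuotientGroup.mk_mul, QuotientGroup.mk_mul, QuotientGroup.mk_inv,
          Subgroup.mem_center_iff.mp hcen (QuotientGroup.mk c), mul_inv_cancel_right]
      have : (⟨QuotientGroup.mk (c * rE q * c⁻¹), hzc⟩ :
          Subgroup.center (K.comap (proj g) ⧸ ⁅(⊤ : Subgroup (K.comap (proj g))), N⁆)) =
          ⟨QuotientGroup.mk (rE q), hcen⟩ := Subtype.ext heq
      rw [this]
      exact Submodule.subset_span ⟨q, rfl⟩
    | one =>
      intro h1
      have : (⟨QuotientGroup.mk 1, h1⟩ : Subgroup.center (K.comap (proj g) ⧸ ⁅(⊤ : Subgroup (K.comap (proj g))), N⁆)) = 1 :=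
        Subtype.ext (QuotientGroup.mk_one _)
      rw [this, ofMul_one]
      exact Submodule.zero_mem _
    | mul y z hy' hz' ihy ihz =>
      intro hyz
      have hyN : y ∈ N := by rw [hN]; exact hy'
      have hzN : z ∈ N := by rw [hN]; exact hz'
      have hyc := QuotientGroup.mk_mem_center_of_mem N hyN
      have hzc := QuotientGroup.mk_mem_center_of_mem N hzN
      have : (⟨QuotientGroup.mk (y * z), hyz⟩ : Subgroup.center (K.comap (proj g) ⧸ ⁅(⊤ : Subgroup (K.comap (proj g))), N⁆)) =
          ⟨QuotientGroup.mk y, hyc⟩ * ⟨QuotientGroup.mk z, hzc⟩ :=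
        Subtype.ext (QuotientGroup.mk_mul _ y z)
      rw [this, ofMul_mul]
      exact Submodule.add_mem _ (ihy hyc) (ihz hzc)
    | inv y hy' ihy =>
      intro hyi
      have hyN : y ∈ N := by rw [hN]; exact hy'
      have hyc := QuotientGroup.mk_mem_center_of_mem N hyN
      have : (⟨QuotientGroup.mk y⁻¹, hyi⟩ : Subgroup.center (K.comap (proj g) ⧸ ⁅(⊤ : Subgroup (K.comap (proj g))), N⁆)) =
          (⟨QuotientGroup.mk y, hyc⟩)⁻¹ :=
        Subtype.ext (QuotientGroup.mk_inv _ y)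
      rw [this, ofMul_inv]
      exact Submodule.neg_mem _ (ihy hyc)
  have hx' : x ∈ normalClosure (Set.range rE) := by rw [← hN]; exact hx
  exact key x hx' hxc

/-! ### In `H₁(E)` the image of `N` is spanned by the images of the conjugates -/

/-- In `Additive (Abelianization E)` the span of the image of `N` is the span of the images of the
transversal conjugates of the relator. [cite: Brown1982CohomologyGroups, II §5 Ex 6] -/
theorem span_image_ker_eq_span_range (K : Subgroup (SurfaceGroup g))
    (u : FreeGroup (surfaceGen g) ⧸ K.comap (proj g) → FreeGroup (surfaceGen g))
    (hu : ∀ q, (u q : FreeGroup (surfaceGen g) ⧸ K.comap (proj g)) = q) :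
    Submodule.span ℤ ((fun x : K.comap (proj g) => Additive.ofMul (Abelianization.of x)) ''
        (((proj g).subgroupComap K).ker : Set (K.comap (proj g)))) =
      Submodule.span ℤ (Set.range fun q : FreeGroup (surfaceGen g) ⧸ K.comap (proj g) =>
        Additive.ofMul (Abelianization.of (⟨(u q)⁻¹ * surfaceRelator g * u q,
          conj_relator_mem_comap K (u q)⟩ : K.comap (proj g)))) := by
  rw [ker_subgroupComap_eq_normalClosure_range K u hu, span_image_normalClosure_eq, ← Set.range_comp]
  rfl

/-! ### `H₁(S_h) = ℤ^{2h}` -/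

/-- `Additive (Abelianization (S_h)) ≃ₗ[ℤ] (surfaceGen h → ℤ)` through the Hurewicz map
`SurfaceGroup.abelianize` (onto, kernel `[S_h, S_h]`). [cite: HatcherAT2002, §1.2 p.51] -/
theorem nonempty_additive_abelianization_surfaceGroup_linearEquiv (h : ℕ) :
    Nonempty (Additive (Abelianization (SurfaceGroup h)) ≃ₗ[ℤ] (surfaceGen h → ℤ)) := by
  let e₁ : Abelianization (SurfaceGroup h) ≃* SurfaceGroup h ⧸ (SurfaceGroup.abelianize h).ker :=
    QuotientGroup.quotientMulEquivOfEq (SurfaceGroup.ker_abelianize h).symm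
  let e₂ : SurfaceGroup h ⧸ (SurfaceGroup.abelianize h).ker ≃* Multiplicative (surfaceGen h → ℤ) :=
    QuotientGroup.quotientKerEquivOfSurjective _ (SurfaceGroup.abelianize_surjective h)
  let e₃ : Additive (Abelianization (SurfaceGroup h)) ≃+ (surfaceGen h → ℤ) :=
    (MulEquiv.toAdditive (e₁.trans e₂)).trans (AddEquiv.refl _)
  exact ⟨e₃.toIntLinearEquiv⟩

/-- `finrank ℤ (Additive (Abelianization S_h)) = 2h`, and the module is finite.
[cite: HatcherAT2002, §1.2 p.51] -/
theorem finrank_additive_abelianization_surfaceGroup (h : ℕ) :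
    Module.finrank ℤ (Additive (Abelianization (SurfaceGroup h))) = 2 * h ∧
      Module.Finite ℤ (Additive (Abelianization (SurfaceGroup h))) := by
  obtain ⟨e⟩ := nonempty_additive_abelianization_surfaceGroup_linearEquiv h
  refine ⟨?_, Module.Finite.equiv e.symm⟩
  rw [e.finrank_eq, Module.finrank_fintype_fun_eq_card]
  simp [surfaceGen, Fintype.card_prod, Fintype.card_bool, Fintype.card_fin, mul_comm]

/-- Transport along `K ≃* S_h`: `finrank ℤ (Additive (Abelianization K)) = 2h` (finite module).
[cite: HatcherAT2002, §1.2 p.51] -/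
theorem finrank_additive_abelianization_of_mulEquiv {G : Type*} [Group G] (e : G ≃* SurfaceGroup h) :
    Module.finrank ℤ (Additive (Abelianization G)) = 2 * h ∧
      Module.Finite ℤ (Additive (Abelianization G)) := by
  obtain ⟨e'⟩ := nonempty_additive_abelianization_surfaceGroup_linearEquiv h
  let e'' : Additive (Abelianization G) ≃ₗ[ℤ] (surfaceGen h → ℤ) :=
    ((MulEquiv.toAdditive e.abelianizationCongr).toIntLinearEquiv).trans e'
  refine ⟨?_, Module.Finite.equiv e''.symm⟩
  rw [e''.finrank_eq, Module.finrank_fintype_fun_eq_card]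
  simp [surfaceGen, Fintype.card_prod, Fintype.card_bool, Fintype.card_fin, mul_comm]

end SurfaceGroup

end Literature.Topology.FourManifolds
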